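import Mathlib
import Literature.Analysis.FluidPDE.VectorCalculus
import Literature.Analysis.FluidPDE.VorticityStretching
import Summits.NavierStokesRegularity.NavierStokesRegularity.Theorems.ThreadingFluxCentreJetDefs
import Summits.NavierStokesRegularity.NavierStokesRegularity.Theorems.ThreadingFluxPlatonicDefs
import Summits.NavierStokesRegularity.NavierStokesRegularity.Theorems.ThreadingFluxPlatonicSymmetryAlgebra
import Summits.NavierStokesRegularity.NavierStokesRegularity.Theorems.ThreadingFluxPlatonicCentreJetAlgebra
import HarnessLib

/-!
# Crux `PoloidalLiouville` (stmt-NavierStokesRegularity-1222, wall W1), crux idea «platonic-germ-sieve» (ns-idea-15 g11, V27):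
# (Π-J) THE O-CLASS IS JET-FLAT TO ORDER TWO AT ITS CENTRE, AND ITS VORTICITY IS 2-FLAT THERE

Support file (Theorems-side; seat ns-wall-eng-7 g9, cell `ns-wall-extremal`, W1 adjunct; director-ns g19 p109 GO; critic ns-wall-crit-1
g7 BATCH #24 NO STRIKE, independent re-derivation; `--supports stmt-NavierStokesRegularity-1222 --as helper`; 0 kit).  A PLACEMENT
lemma between two cards of the same custodian — «platonic-germ-sieve» (lens negation; `OctahedralCentreRigidity`, the sieve's conjecture)
and «centre-jet» (eng-7 g5–g7; `CentreJet.TriaxialToroidalJetRigidity`, `CentreJet.PolhodeForcing`) — with NO Navier–Stokes input: pure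
symmetry.  For a field `V : ℝ³ → ℝ³` of class `C²` (`C³` for (J3)) on `ball 0 ρ`, O-equivariant there in the EXACT binder of
`Platonic.OctahedralCentreRigidity` (`∀ x ∈ ball 0 ρ, ∀ σ s, IsCubeRotationData σ s → cubeRot σ s x ∈ ball 0 ρ →
V (cubeRot σ s x) = cubeRot σ s (V x)`):

* (J0) `CentreFlat.centre_eq_zero` — `V 0 = 0`;
* (J1) `CentreFlat.fderiv_centre_eq_smul_id` — `DV(0) = (div V(0)/3) · id` (Schur), hence `curl V 0 = 0` (`curl_centre_eq_zero`) and
  `DV(0) = 0` when `div V(0) = 0` (`fderiv_centre_eq_zero`);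
* (J2) `CentreFlat.fderiv_fderiv_centre_eq_zero` — `D²V(0) = 0` (no symmetric quadratic O-equivariant; symmetry of `D²V(0)` from
  `ContDiffAt.isSymmSndFDerivAt`), hence `ΔV(0) = 0` (`laplacian_centre_eq_zero`) and `D(curl V)(0) = 0` (`fderiv_curl_centre_eq_zero`,
  via the tree's `curl_eq_curlCLM_comp`);
* (J3) `CentreFlat.fderiv_fderiv_curl_centre_eq_zero` — `D²(curl V)(0) = 0`: the vorticity `ω = curl V` is itself O-equivariant on the
  ball (the curl is a pseudo-vector and O ⊂ SO(3): `curl_equivariant_halfTurn` / `_cycle` / `_quarterTurn`), so the (J2) engine re-runs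
  on `ω`.  Equivalently: the symmetric O-equivariant cubic jets are spanned by the jets of `∇‖x‖⁴` and `∇Σxᵢ⁴`, both gradients;
* PLACEMENT `CentreFlat.not_triaxial_centre` — the triaxial-strain binder of `CentreJet.TriaxialToroidalJetRigidity` /
  `CentreJet.PolhodeForcing` (an orthonormal eigenbasis of `DV(0)` with three DISTINCT rates) is unsatisfiable on O-germs
  (`DV(0) = λ·id`): the centre-jet sieve (α)/(β)/C1* is VACUOUS on the O-class — the platonic card's «fully degenerate centre residue
  that g5's C1* left untouched» as a kernel fact — and `OctahedralCentreRigidity`'s conclusion `curl V = 0` holds THROUGH SECOND ORDER at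
  the centre for free; what is OPEN starts at the vorticity 3-jet;
* global forms for `IsEquivariant octahedral V` with `ContDiff ℝ 2 V` / `ContDiff ℝ 3 V` (`centre_jets_of_isEquivariant`,
  `curl_two_flat_of_isEquivariant`).

METHOD.  One transport lemma — `F₁ ∘ L = L ∘ F₂` near `x` ⇒ `DF₁(Lx)[Lv] = L(DF₂(x)[v])` (chain rule + uniqueness of the derivative) —
iterated along the ball (`fderiv_equivariant`, `fderiv_fderiv_equivariant`), then the finite-dimensional algebra of
`ThreadingFluxPlatonicCentreJetAlgebra.lean` at `x = 0`.  SHARPNESS (remark, not formalised): the O-equivariant quartic `h₄ · x`,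
`h₄ = Σxᵢ⁴ − (3/5)‖x‖⁴`, has `curl (h₄ x) = ∇h₄ × x` with a non-zero 3-jet — order three is the first order at which steady NS / the sieve
has to act (the custodian's cascade: first vortical slot β, `Cruxes/PoloidalLiouville/PlatonicSieveResults.md` §1).  «O, NOT T»: for the
tetrahedral class (J2) fails (`∇(x₀x₁x₂)`).  HONEST LABEL: representation-theoretic/kinematic information strictly below W1 (no NS input),
W1 movement 0; no Prop of either sketch is closed; `OctahedralCentreRigidity`, `PoloidalLiouville` (1222), `UnthreadedRigidity` (27585)
and NS regularity are OPEN — NOT proved.  [folklore; Solomon 1963 for the invariant theory behind it]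
-/

-- the summit and its single sub-problem share the name (CONVENTIONS §1)
set_option linter.dupNamespace false

noncomputable section

open Set Function Filter Metric
open scoped RealInnerProductSpace Topology
open Literature.Analysis.FluidPDE
open Summit.NavierStokesRegularity.NavierStokesRegularity.Theorems.PoloidalLiouville.CentreJet (E3)

namespace Summit.NavierStokesRegularity.NavierStokesRegularity.Theorems.PoloidalLiouville.Platonic

namespace CentreFlat

/-! ### Transport of an equivariance through derivatives -/

/-- Sign data preserve the norm: `‖cubeRot σ s x‖ = ‖x‖` when every `sᵢ = ±1`. -/
theorem norm_cubeRot {σ : Equiv.Perm (Fin 3)} {s : Fin 3 → ℝ} (hs : ∀ i, s i = 1 ∨ s i = -1) (x : E3) :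
    ‖cubeRot σ s x‖ = ‖x‖ := by
  have hsq : ∀ i, s i ^ 2 = 1 := fun i => by rcases hs i with h | h <;> simp [h]
  rw [EuclideanSpace.norm_eq, EuclideanSpace.norm_eq]
  congr 1
  have : ∀ i, ‖cubeRot σ s x i‖ ^ 2 = ‖x (σ i)‖ ^ 2 := fun i => by
    simp only [cubeRot, PiLp.toLp_apply, Real.norm_eq_abs, sq_abs, mul_pow, hsq i, one_mul]
  simp_rw [this]
  exact Equiv.sum_comp σ (fun j => ‖x j‖ ^ 2)

/-- A rotation of the cube maps the ball `ball 0 ρ` into itself. -/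
theorem cubeRot_mem_ball {σ : Equiv.Perm (Fin 3)} {s : Fin 3 → ℝ} (hd : IsCubeRotationData σ s) {ρ : ℝ} {x : E3}
    (hx : x ∈ ball (0 : E3) ρ) : cubeRot σ s x ∈ ball (0 : E3) ρ := by
  rw [mem_ball_zero_iff] at hx ⊢
  rwa [norm_cubeRot hd.1]

/-- **Transport of an equivariance through one derivative.**  If `F₁ ∘ L = L ∘ F₂` near `x` for a continuous linear `L`, then
`DF₁(L x)[L v] = L (DF₂(x)[v])`. -/
theorem fderiv_transport {F₁ F₂ : E3 → E3} (L : E3 →L[ℝ] E3) {x : E3}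
    (h : ∀ᶠ y in 𝓝 x, F₁ (L y) = L (F₂ y)) (h₁ : DifferentiableAt ℝ F₁ (L x)) (h₂ : DifferentiableAt ℝ F₂ x)
    (v : E3) : fderiv ℝ F₁ (L x) (L v) = L (fderiv ℝ F₂ x v) := by
  have hc₁ : HasFDerivAt (fun y => F₁ (L y)) ((fderiv ℝ F₁ (L x)).comp L) x :=
    h₁.hasFDerivAt.comp x L.hasFDerivAt
  have hc₂ : HasFDerivAt (fun y => L (F₂ y)) (L.comp (fderiv ℝ F₂ x)) x :=
    L.hasFDerivAt.comp x h₂.hasFDerivAt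
  have h' : (fun y => L (F₂ y)) =ᶠ[𝓝 x] (fun y => F₁ (L y)) := h.mono fun y hy => hy.symm
  have heq : (fderiv ℝ F₁ (L x)).comp L = L.comp (fderiv ℝ F₂ x) := (hc₁.congr_of_eventuallyEq h').unique hc₂
  simpa using congrArg (fun T : E3 →L[ℝ] E3 => T v) heq

section Engine

variable {F : E3 → E3} {ρ : ℝ} {σ : Equiv.Perm (Fin 3)} {s : Fin 3 → ℝ}

/-- First transport: `DF(g x)[g v] = g (DF(x)[v])` on the ball, for a rotation of the cube `g` under which `F` is equivariant
on the ball. -/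
theorem fderiv_equivariant (hF : ContDiffOn ℝ 1 F (ball 0 ρ)) (hd : IsCubeRotationData σ s)
    (heq : ∀ x ∈ ball (0 : E3) ρ, F (cubeRot σ s x) = cubeRot σ s (F x)) {x : E3} (hx : x ∈ ball (0 : E3) ρ) (v : E3) :
    fderiv ℝ F (cubeRot σ s x) (cubeRot σ s v) = cubeRot σ s (fderiv ℝ F x v) := by
  obtain ⟨L, hL⟩ := exists_clm_cubeRot σ s
  have hdiff : ∀ y ∈ ball (0 : E3) ρ, DifferentiableAt ℝ F y := fun y hy =>
    (hF.differentiableOn one_ne_zero).differentiableAt (isOpen_ball.mem_nhds hy)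
  have hev : ∀ᶠ y in 𝓝 x, F (L y) = L (F y) := by
    filter_upwards [isOpen_ball.mem_nhds hx] with y hy
    rw [hL, hL]; exact heq y hy
  have key := fderiv_transport L hev (by rw [hL]; exact hdiff _ (cubeRot_mem_ball hd hx)) (hdiff x hx) v
  rwa [hL, hL, hL] at key

/-- Second transport: `D²F(g x)[g u, g v] = g (D²F(x)[u, v])` on the ball. -/
theorem fderiv_fderiv_equivariant (hF : ContDiffOn ℝ 2 F (ball 0 ρ)) (hd : IsCubeRotationData σ s)
    (heq : ∀ x ∈ ball (0 : E3) ρ, F (cubeRot σ s x) = cubeRot σ s (F x)) {x : E3} (hx : x ∈ ball (0 : E3) ρ) (v u : E3) :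
    fderiv ℝ (fderiv ℝ F) (cubeRot σ s x) (cubeRot σ s v) (cubeRot σ s u) =
      cubeRot σ s (fderiv ℝ (fderiv ℝ F) x v u) := by
  obtain ⟨L, hL⟩ := exists_clm_cubeRot σ s
  have hW : ContDiffOn ℝ 1 (fderiv ℝ F) (ball 0 ρ) := hF.fderiv_of_isOpen isOpen_ball (by norm_num)
  have hWd : ∀ y ∈ ball (0 : E3) ρ, DifferentiableAt ℝ (fderiv ℝ F) y := fun y hy =>
    (hW.differentiableOn one_ne_zero).differentiableAt (isOpen_ball.mem_nhds hy)
  -- the first transport as an identity of functions near `x`: `(D F)(L y)[L u] = L ((D F)(y)[u])`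
  have hev : ∀ᶠ y in 𝓝 x, (fun z => fderiv ℝ F z (L u)) (L y) = L ((fun z => fderiv ℝ F z u) y) := by
    filter_upwards [isOpen_ball.mem_nhds hx] with y hy
    simp only [hL]
    exact fderiv_equivariant (hF.of_le (by norm_num)) hd heq hy u
  have h₁ : DifferentiableAt ℝ (fun z => fderiv ℝ F z (L u)) (L x) := by
    simp only [hL]; exact (hWd _ (cubeRot_mem_ball hd hx)).clm_apply (differentiableAt_const _)
  have h₂ : DifferentiableAt ℝ (fun z => fderiv ℝ F z u) x := (hWd x hx).clm_apply (differentiableAt_const _)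
  have key := fderiv_transport L hev h₁ h₂ v
  -- evaluate the derivatives of `z ↦ DF(z)[w]`
  have happ : ∀ (y w v' : E3), DifferentiableAt ℝ (fderiv ℝ F) y →
      fderiv ℝ (fun z => fderiv ℝ F z w) y v' = fderiv ℝ (fderiv ℝ F) y v' w := by
    intro y w v' hy
    rw [fderiv_clm_apply hy (differentiableAt_const w)]
    simp
  rw [happ _ _ _ (by rw [hL]; exact hWd _ (cubeRot_mem_ball hd hx)), happ _ _ _ (hWd x hx)] at key
  simpa only [hL] using key

end Engine


section Jets

variable {V : E3 → E3} {ρ : ℝ}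

/-- `cubeRot σ s` fixes the origin. -/
theorem cubeRot_zero (σ : Equiv.Perm (Fin 3)) (s : Fin 3 → ℝ) : cubeRot σ s (0 : E3) = 0 := by
  ext i; simp [cubeRot]

/-- From the sketch's binder (equivariance on the ball, guarded by membership) to plain equivariance on the ball. -/
theorem equivariant_on_ball
    (heq : ∀ x ∈ ball (0 : E3) ρ, ∀ σ s, IsCubeRotationData σ s → cubeRot σ s x ∈ ball (0 : E3) ρ →
      V (cubeRot σ s x) = cubeRot σ s (V x))
    {σ : Equiv.Perm (Fin 3)} {s : Fin 3 → ℝ} (hd : IsCubeRotationData σ s) :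
    ∀ x ∈ ball (0 : E3) ρ, V (cubeRot σ s x) = cubeRot σ s (V x) :=
  fun x hx => heq x hx σ s hd (cubeRot_mem_ball hd hx)

/-- **(J0) The centre value vanishes**: an O-equivariant field has `V 0 = 0` (O fixes no vector; two half-turns suffice). -/
theorem centre_eq_zero (hρ : 0 < ρ)
    (heq : ∀ x ∈ ball (0 : E3) ρ, ∀ σ s, IsCubeRotationData σ s → cubeRot σ s x ∈ ball (0 : E3) ρ →
      V (cubeRot σ s x) = cubeRot σ s (V x)) :
    V 0 = 0 := by
  have h0 := equivariant_on_ball heq isCubeRotationData_halfTurn₀ 0 (mem_ball_self hρ)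
  have h1 := equivariant_on_ball heq isCubeRotationData_halfTurn₁ 0 (mem_ball_self hρ)
  rw [cubeRot_zero] at h0 h1
  have a1 := congrArg (fun w : E3 => w 1) h0
  have a2 := congrArg (fun w : E3 => w 2) h0
  have a0 := congrArg (fun w : E3 => w 0) h1
  simp only [cubeRot_one_apply] at a0 a1 a2
  norm_num [Matrix.cons_val_two, Matrix.tail_cons, Matrix.head_cons] at a0 a1 a2
  have c0 : V 0 0 = 0 := by linarith
  have c1 : V 0 1 = 0 := by linarith
  have c2 : V 0 2 = 0 := by linarith
  ext i
  fin_cases i <;> simp only [PiLp.zero_apply] <;> first | exact c0 | exact c1 | exact c2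

/-- **(J1) Schur at the centre**: the velocity gradient of an O-equivariant `C¹` germ at the centre is the scalar
`(div V(0)/3) · id`. -/
theorem fderiv_centre_eq_smul_id (hρ : 0 < ρ) (hV : ContDiffOn ℝ 1 V (ball 0 ρ))
    (heq : ∀ x ∈ ball (0 : E3) ρ, ∀ σ s, IsCubeRotationData σ s → cubeRot σ s x ∈ ball (0 : E3) ρ →
      V (cubeRot σ s x) = cubeRot σ s (V x)) :
    fderiv ℝ V 0 = (VectorCalculus.divergence V 0 / 3) • ContinuousLinearMap.id ℝ E3 := by
  have hcomm : ∀ {σ : Equiv.Perm (Fin 3)} {s : Fin 3 → ℝ}, IsCubeRotationData σ s →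
      ∀ v, fderiv ℝ V 0 (cubeRot σ s v) = cubeRot σ s (fderiv ℝ V 0 v) := by
    intro σ s hd v
    have := fderiv_equivariant hV hd (equivariant_on_ball heq hd) (mem_ball_self hρ) v
    rwa [cubeRot_zero] at this
  have hD := clm_eq_smul_id (fderiv ℝ V 0) (hcomm isCubeRotationData_halfTurn₀) (hcomm isCubeRotationData_halfTurn₁)
    (hcomm isCubeRotationData_cycle)
  have hdiv : VectorCalculus.divergence V 0 = 3 * fderiv ℝ V 0 (EuclideanSpace.single 0 (1 : ℝ)) 0 := by
    unfold VectorCalculus.divergence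
    rw [trace_eq_sum_coord, hD]
    simp
  rw [hD, hdiv]
  congr 1
  ring

/-- (J1′) In particular the vorticity vanishes at the centre. -/
theorem curl_centre_eq_zero (hρ : 0 < ρ) (hV : ContDiffOn ℝ 1 V (ball 0 ρ))
    (heq : ∀ x ∈ ball (0 : E3) ρ, ∀ σ s, IsCubeRotationData σ s → cubeRot σ s x ∈ ball (0 : E3) ρ →
      V (cubeRot σ s x) = cubeRot σ s (V x)) :
    curl V 0 = 0 := by
  rw [curl_eq_curlCLM, fderiv_centre_eq_smul_id hρ hV heq, map_smul, curlCLM_apply]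
  ext i
  fin_cases i <;> simp

/-- (J1″) … and the full velocity gradient vanishes at the centre when `div V(0) = 0`. -/
theorem fderiv_centre_eq_zero (hρ : 0 < ρ) (hV : ContDiffOn ℝ 1 V (ball 0 ρ))
    (heq : ∀ x ∈ ball (0 : E3) ρ, ∀ σ s, IsCubeRotationData σ s → cubeRot σ s x ∈ ball (0 : E3) ρ →
      V (cubeRot σ s x) = cubeRot σ s (V x))
    (hdiv : VectorCalculus.divergence V 0 = 0) : fderiv ℝ V 0 = 0 := by
  rw [fderiv_centre_eq_smul_id hρ hV heq, hdiv]
  ext v i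
  simp

/-- **(J2) No quadratic jet**: the second derivative of an O-equivariant `C²` germ vanishes at the centre. -/
theorem fderiv_fderiv_centre_eq_zero (hρ : 0 < ρ) (hV : ContDiffOn ℝ 2 V (ball 0 ρ))
    (heq : ∀ x ∈ ball (0 : E3) ρ, ∀ σ s, IsCubeRotationData σ s → cubeRot σ s x ∈ ball (0 : E3) ρ →
      V (cubeRot σ s x) = cubeRot σ s (V x)) :
    fderiv ℝ (fderiv ℝ V) 0 = 0 := by
  have hsym : ∀ u v : E3, fderiv ℝ (fderiv ℝ V) 0 u v = fderiv ℝ (fderiv ℝ V) 0 v u :=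
    fun u v => (hV.contDiffAt (isOpen_ball.mem_nhds (mem_ball_self hρ))).isSymmSndFDerivAt (by simp) u v
  have hcomm : ∀ {σ : Equiv.Perm (Fin 3)} {s : Fin 3 → ℝ}, IsCubeRotationData σ s →
      ∀ u v, fderiv ℝ (fderiv ℝ V) 0 (cubeRot σ s u) (cubeRot σ s v) = cubeRot σ s (fderiv ℝ (fderiv ℝ V) 0 u v) := by
    intro σ s hd u v
    have := fderiv_fderiv_equivariant hV hd (equivariant_on_ball heq hd) (mem_ball_self hρ) u v
    rwa [cubeRot_zero] at this
  exact bilin_eq_zero _ hsym (hcomm isCubeRotationData_halfTurn₀) (hcomm isCubeRotationData_halfTurn₁)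
    (hcomm isCubeRotationData_cycle) (hcomm isCubeRotationData_quarterTurn)

/-- (J2′) Hence the Laplacian of the field vanishes at the centre. -/
theorem laplacian_centre_eq_zero (hρ : 0 < ρ) (hV : ContDiffOn ℝ 2 V (ball 0 ρ))
    (heq : ∀ x ∈ ball (0 : E3) ρ, ∀ σ s, IsCubeRotationData σ s → cubeRot σ s x ∈ ball (0 : E3) ρ →
      V (cubeRot σ s x) = cubeRot σ s (V x)) :
    Laplacian.laplacian V 0 = 0 := by
  rw [InnerProductSpace.laplacian_eq_iteratedFDeriv_orthonormalBasis V (EuclideanSpace.basisFun (Fin 3) ℝ)]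
  simp only [iteratedFDeriv_two_apply, fderiv_fderiv_centre_eq_zero hρ hV heq]
  simp

/-- (J2″) … and the vorticity GRADIENT vanishes at the centre (`curl V = curlCLM ∘ DV`). -/
theorem fderiv_curl_centre_eq_zero (hρ : 0 < ρ) (hV : ContDiffOn ℝ 2 V (ball 0 ρ))
    (heq : ∀ x ∈ ball (0 : E3) ρ, ∀ σ s, IsCubeRotationData σ s → cubeRot σ s x ∈ ball (0 : E3) ρ →
      V (cubeRot σ s x) = cubeRot σ s (V x)) :
    fderiv ℝ (curl V) 0 = 0 := by
  have hW : ContDiffOn ℝ 1 (fderiv ℝ V) (ball 0 ρ) := hV.fderiv_of_isOpen isOpen_ball (by norm_num)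
  have hWd : DifferentiableAt ℝ (fderiv ℝ V) 0 :=
    (hW.differentiableOn one_ne_zero).differentiableAt (isOpen_ball.mem_nhds (mem_ball_self hρ))
  rw [curl_eq_curlCLM_comp, (curlCLM.hasFDerivAt.comp (0 : E3) hWd.hasFDerivAt).fderiv,
    fderiv_fderiv_centre_eq_zero hρ hV heq, ContinuousLinearMap.comp_zero]

/-- **Placement against the centre-jet card (ns-idea-15 g5, eng-7 g5–g7).**  The TRIAXIAL-STRAIN binder of
`CentreJet.TriaxialToroidalJetRigidity` / `CentreJet.PolhodeForcing` — an orthonormal eigenbasis of `DV(x₀)` with three DISTINCT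
rates — is unsatisfiable at the centre of an O-equivariant `C¹` germ: `DV(0) = λ·id` has a triple eigenvalue.  The centre-jet sieve
(α)/(β)/C1* is vacuous on the O-class. -/
theorem not_triaxial_centre (hρ : 0 < ρ) (hV : ContDiffOn ℝ 1 V (ball 0 ρ))
    (heq : ∀ x ∈ ball (0 : E3) ρ, ∀ σ s, IsCubeRotationData σ s → cubeRot σ s x ∈ ball (0 : E3) ρ →
      V (cubeRot σ s x) = cubeRot σ s (V x)) :
    ¬ ∃ (u : Fin 3 → E3) (e : Fin 3 → ℝ), Orthonormal ℝ u ∧ Function.Injective e ∧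
        ∀ i, fderiv ℝ V 0 (u i) = e i • u i := by
  rintro ⟨u, e, hu, he, hdiag⟩
  have hD := fderiv_centre_eq_smul_id hρ hV heq
  have hall : ∀ i, e i = VectorCalculus.divergence V 0 / 3 := by
    intro i
    have h := hdiag i
    rw [hD] at h
    simp only [FunLike.coe_smul, Pi.smul_apply, ContinuousLinearMap.coe_id', id_eq] at h
    have hui : u i ≠ 0 := hu.ne_zero i
    by_contra hne
    have : (VectorCalculus.divergence V 0 / 3 - e i) • u i = 0 := by rw [sub_smul, h, sub_self]
    rcases smul_eq_zero.mp this with h' | h'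
    · exact hne (by linarith)
    · exact hui h'
  exact absurd (he ((hall 0).trans (hall 1).symm)) (by decide)

end Jets

section Vorticity

variable {V : E3 → E3} {ρ : ℝ}

/-- **The vorticity of an O-equivariant field is O-equivariant on the ball** (generators: half-turns with `∏ sᵢ = 1`). -/
theorem curl_equivariant_halfTurn {s : Fin 3 → ℝ} (hd : IsCubeRotationData 1 s) (hV : ContDiffOn ℝ 1 V (ball 0 ρ))
    (heq : ∀ x ∈ ball (0 : E3) ρ, V (cubeRot 1 s x) = cubeRot 1 s (V x)) :
    ∀ x ∈ ball (0 : E3) ρ, curl V (cubeRot 1 s x) = cubeRot 1 s (curl V x) := by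
  intro x hx
  have hprod : s 0 * s 1 * s 2 = 1 := by
    have := hd.2; simp [Fin.prod_univ_three] at this; linarith [this]
  rw [curl_eq_curlCLM, curl_eq_curlCLM]
  exact curlCLM_halfTurn hd.1 hprod (fun v => fderiv_equivariant hV hd heq hx v)

/-- The vorticity of an O-equivariant field is O-equivariant on the ball — the 3-cycle. -/
theorem curl_equivariant_cycle (hV : ContDiffOn ℝ 1 V (ball 0 ρ))
    (heq : ∀ x ∈ ball (0 : E3) ρ, V (cubeRot (finRotate 3) (fun _ => 1) x) = cubeRot (finRotate 3) (fun _ => 1) (V x)) :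
    ∀ x ∈ ball (0 : E3) ρ, curl V (cubeRot (finRotate 3) (fun _ => 1) x) =
      cubeRot (finRotate 3) (fun _ => 1) (curl V x) := by
  intro x hx
  rw [curl_eq_curlCLM, curl_eq_curlCLM]
  exact curlCLM_cycle (fun v => fderiv_equivariant hV isCubeRotationData_cycle heq hx v)

/-- The vorticity of an O-equivariant field is O-equivariant on the ball — the quarter-turn. -/
theorem curl_equivariant_quarterTurn (hV : ContDiffOn ℝ 1 V (ball 0 ρ))
    (heq : ∀ x ∈ ball (0 : E3) ρ, V (cubeRot (Equiv.swap 0 1) ![-1, 1, 1] x) = cubeRot (Equiv.swap 0 1) ![-1, 1, 1] (V x)) :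
    ∀ x ∈ ball (0 : E3) ρ, curl V (cubeRot (Equiv.swap 0 1) ![-1, 1, 1] x) =
      cubeRot (Equiv.swap 0 1) ![-1, 1, 1] (curl V x) := by
  intro x hx
  rw [curl_eq_curlCLM, curl_eq_curlCLM]
  exact curlCLM_quarterTurn (fun v => fderiv_equivariant hV isCubeRotationData_quarterTurn heq hx v)

/-- **(J3) The vorticity of an O-equivariant `C³` germ is 2-flat at the centre**: `D²(curl V)(0) = 0`.  (With (J1′)
`curl V(0) = 0` and (J2″) `D(curl V)(0) = 0`: the 2-jet of `ω` at the centre vanishes.)  The symmetric O-equivariant cubic jets are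
spanned by the jets of `∇‖x‖⁴` and `∇Σxᵢ⁴` — both gradients — so the cubic Taylor term of `V` is curl-free; here this is reached by
re-running the (J2) engine on `ω`, which is O-equivariant on the ball because the curl is a pseudo-vector and O ⊂ SO(3). -/
theorem fderiv_fderiv_curl_centre_eq_zero (hρ : 0 < ρ) (hV : ContDiffOn ℝ 3 V (ball 0 ρ))
    (heq : ∀ x ∈ ball (0 : E3) ρ, ∀ σ s, IsCubeRotationData σ s → cubeRot σ s x ∈ ball (0 : E3) ρ →
      V (cubeRot σ s x) = cubeRot σ s (V x)) :
    fderiv ℝ (fderiv ℝ (curl V)) 0 = 0 := by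
  have hV1 : ContDiffOn ℝ 1 V (ball 0 ρ) := hV.of_le (by norm_num)
  have hω : ContDiffOn ℝ 2 (curl V) (ball 0 ρ) := by
    rw [curl_eq_curlCLM_comp]
    exact curlCLM.contDiff.comp_contDiffOn (hV.fderiv_of_isOpen isOpen_ball (by norm_num))
  have hsym : ∀ u v : E3, fderiv ℝ (fderiv ℝ (curl V)) 0 u v = fderiv ℝ (fderiv ℝ (curl V)) 0 v u :=
    fun u v => (hω.contDiffAt (isOpen_ball.mem_nhds (mem_ball_self hρ))).isSymmSndFDerivAt (by simp) u v
  have hcomm : ∀ {σ : Equiv.Perm (Fin 3)} {s : Fin 3 → ℝ}, IsCubeRotationData σ s →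
      (∀ x ∈ ball (0 : E3) ρ, curl V (cubeRot σ s x) = cubeRot σ s (curl V x)) →
      ∀ u v, fderiv ℝ (fderiv ℝ (curl V)) 0 (cubeRot σ s u) (cubeRot σ s v) =
        cubeRot σ s (fderiv ℝ (fderiv ℝ (curl V)) 0 u v) := by
    intro σ s hd hω_eq u v
    have := fderiv_fderiv_equivariant hω hd hω_eq (mem_ball_self hρ) u v
    rwa [cubeRot_zero] at this
  exact bilin_eq_zero _ hsym
    (hcomm isCubeRotationData_halfTurn₀
      (curl_equivariant_halfTurn isCubeRotationData_halfTurn₀ hV1 (equivariant_on_ball heq isCubeRotationData_halfTurn₀)))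
    (hcomm isCubeRotationData_halfTurn₁
      (curl_equivariant_halfTurn isCubeRotationData_halfTurn₁ hV1 (equivariant_on_ball heq isCubeRotationData_halfTurn₁)))
    (hcomm isCubeRotationData_cycle (curl_equivariant_cycle hV1 (equivariant_on_ball heq isCubeRotationData_cycle)))
    (hcomm isCubeRotationData_quarterTurn
      (curl_equivariant_quarterTurn hV1 (equivariant_on_ball heq isCubeRotationData_quarterTurn)))

end Vorticity

section Global

variable {V : E3 → E3}

/-- From global O-equivariance (`IsEquivariant octahedral V`) to the sketch's binder on the unit ball. -/
theorem ballBinder_of_isEquivariant (heq : IsEquivariant octahedral V) :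
    ∀ x ∈ ball (0 : E3) 1, ∀ σ s, IsCubeRotationData σ s → cubeRot σ s x ∈ ball (0 : E3) 1 →
      V (cubeRot σ s x) = cubeRot σ s (V x) :=
  fun x _ σ s hd _ => heq _ ⟨σ, s, hd, rfl⟩ x

/-- **(J0)–(J2), global form.**  For a `C²` field on `ℝ³`, equivariant under the octahedral rotation group: `V(0) = 0`,
`DV(0) = (div V(0)/3)·id`, `D²V(0) = 0`, `curl V(0) = 0`, `D(curl V)(0) = 0`, `ΔV(0) = 0`. -/
theorem centre_jets_of_isEquivariant (hV : ContDiff ℝ 2 V) (heq : IsEquivariant octahedral V) :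
    V 0 = 0 ∧ fderiv ℝ V 0 = (VectorCalculus.divergence V 0 / 3) • ContinuousLinearMap.id ℝ E3 ∧
      fderiv ℝ (fderiv ℝ V) 0 = 0 ∧ curl V 0 = 0 ∧ fderiv ℝ (curl V) 0 = 0 ∧ Laplacian.laplacian V 0 = 0 := by
  have hb := ballBinder_of_isEquivariant heq
  have h2 : ContDiffOn ℝ 2 V (ball 0 1) := hV.contDiffOn
  have h1 : ContDiffOn ℝ 1 V (ball 0 1) := (hV.of_le (by norm_num)).contDiffOn
  exact ⟨centre_eq_zero one_pos hb, fderiv_centre_eq_smul_id one_pos h1 hb, fderiv_fderiv_centre_eq_zero one_pos h2 hb,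
    curl_centre_eq_zero one_pos h1 hb, fderiv_curl_centre_eq_zero one_pos h2 hb, laplacian_centre_eq_zero one_pos h2 hb⟩

/-- **(J3), global form.**  For a `C³` field on `ℝ³`, equivariant under the octahedral rotation group, the vorticity is 2-flat at the
centre: `curl V(0) = 0`, `D(curl V)(0) = 0`, `D²(curl V)(0) = 0`. -/
theorem curl_two_flat_of_isEquivariant (hV : ContDiff ℝ 3 V) (heq : IsEquivariant octahedral V) :
    curl V 0 = 0 ∧ fderiv ℝ (curl V) 0 = 0 ∧ fderiv ℝ (fderiv ℝ (curl V)) 0 = 0 := by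
  have hb := ballBinder_of_isEquivariant heq
  exact ⟨curl_centre_eq_zero one_pos (hV.of_le (by norm_num)).contDiffOn hb,
    fderiv_curl_centre_eq_zero one_pos (hV.of_le (by norm_num)).contDiffOn hb,
    fderiv_fderiv_curl_centre_eq_zero one_pos hV.contDiffOn hb⟩

end Global

end CentreFlat

end Summit.NavierStokesRegularity.NavierStokesRegularity.Theorems.PoloidalLiouville.Platonic

end
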